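import Summits.Ventures.PercRepro.S1CoreFourCircuitSum

/-!
# PercRepro — THE CLOSED FORMS OF p1's `perPointBound` AND `fourCircuitBound` (p8, gen 21; a feeder for S4 — the top of the
`q = 7` window, the rows `55` and below)

p1's T4⁺ (S1CoreFourCircuitSum) bounds the four-circuits of an `e`-free core of nullity `d` by
`fourCircuitBound d = Σ_{j ≤ d} perPointBound j`, `perPointBound j = Σ_{i ≤ j} ⌊3i/2⌋` — finite sums that the row modules
must evaluate at every corank `d ≤ 105` (`decide` overflows the recursion depth from `d ≈ 60`). The closed forms:
* **`four_mul_perPointBound`** — `4·perPointBound j + (j mod 2) = 3j² + 2j`, i.e. `perPointBound j = ⌊(3j² + 2j)/4⌋`;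
* **`eight_mul_fourCircuitBound`** — `8·fourCircuitBound d + 2⌈d/2⌉ = d(d+1)(2d+3)`;
* **`fourCircuitBound_eq`** — `fourCircuitBound d = (d(d+1)(2d+3) − 2⌈d/2⌉)/8` (exact division), so that
  `norm_num [fourCircuitBound_eq]` evaluates it at any numeral (`fourCircuitBound 13 = 658`, `fourCircuitBound 103 = 279838`).
Axioms: standard.
-/

namespace PercRepro

namespace S1

/-- `2·⌊3i/2⌋ + (i mod 2) = 3i`. -/
theorem two_mul_three_mul_div_two_add (i : ℕ) : 2 * (3 * i / 2) + i % 2 = 3 * i := by omega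

/-- **The closed form of `perPointBound`**: `4·perPointBound j + (j mod 2) = 3j² + 2j`. -/
theorem four_mul_perPointBound (j : ℕ) : 4 * perPointBound j + j % 2 = 3 * (j * j) + 2 * j := by
  induction j with
  | zero => simp [perPointBound]
  | succ j ih =>
    rw [perPointBound_succ]
    have h := two_mul_three_mul_div_two_add (j + 1)
    have hsq : (j + 1) * (j + 1) = j * j + 2 * j + 1 := by ring
    rw [hsq]
    omega

/-- **The closed form of `fourCircuitBound`**: `8·fourCircuitBound d + 2⌈d/2⌉ = d(d+1)(2d+3)`. -/
theorem eight_mul_fourCircuitBound (d : ℕ) :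
    8 * fourCircuitBound d + 2 * ((d + 1) / 2) = d * (d + 1) * (2 * d + 3) := by
  induction d with
  | zero => simp [fourCircuitBound, perPointBound]
  | succ d ih =>
    rw [fourCircuitBound_succ]
    have h := four_mul_perPointBound (d + 1)
    have e1 : (d + 1) * (d + 1 + 1) * (2 * (d + 1) + 3) =
        d * (d + 1) * (2 * d + 3) + 6 * ((d + 1) * (d + 1)) + 4 * (d + 1) := by ring
    rw [e1]
    omega

/-- `fourCircuitBound d = (d(d+1)(2d+3) − 2⌈d/2⌉)/8`, the form `norm_num` evaluates at a numeral. -/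
theorem fourCircuitBound_eq (d : ℕ) :
    fourCircuitBound d = (d * (d + 1) * (2 * d + 3) - 2 * ((d + 1) / 2)) / 8 := by
  have := eight_mul_fourCircuitBound d
  omega

/-- `perPointBound j = (3j² + 2j)/4`. -/
theorem perPointBound_eq (j : ℕ) : perPointBound j = (3 * (j * j) + 2 * j) / 4 := by
  have := four_mul_perPointBound j
  omega

example : fourCircuitBound 13 = 658 := by norm_num [fourCircuitBound_eq]
example : fourCircuitBound 103 = 279838 := by norm_num [fourCircuitBound_eq]

end S1

end PercRepro
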